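import Mathlib
import HarnessLib

/-!
# FunctionalMining/NoGo — two notches: finite cores of QUEUE PARITY and the STATIC CHARGE BOUND
# (COLLAPSE-ADDENDUM-4 §Q′: LEMMA F14 (2)–(4), THEOREM R₂″, §Q′.7), staged by the no-go seat (cell `pub-nsfunc`, nogo gen 17)

Search for candidate a priori estimates; no regularity claim. The planner seat cannot file under
`FunctionalMining/`; this file is STAGED for the prove seat, in the style of `NoGo/OneNotchRangeCollapse.lean`
and `NoGo/TwoNotchEpisodeBudget.lean` (independent of both; `import Mathlib` only).

Setting (informal; strict two-notch rule book, sizes `d > t > u > 0`). In a live channel `C = [M → P]` every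
`−t` member starts its u-career with the same absolute chirality `χ = χ_C ∈ {±1}` and alternates (THEOREM R₂(ii),
LEMMA F14(1), prose). Consequently every u-queue of the channel, read outward from the member (or main) at its
inner end, is a list of u-signs `∓χ, ±χ, ∓χ, …` indexed by an interval of event numbers `j ∈ [m, n)`:
the behind-deposits of a `−t` carry signs `−χ·(−1)^j`, its ahead-deposits `+χ·(−1)^j` (`j` = event number − 1),
and a queue between a `+t` with `m` events so far and a `−t` with `n ≥ m` events consists of the elements
`j = m, …, n−1`. Writing `memberU V χ u e := V − χ·u·(1 − (−1)^e)/2` (`= V − χ·u·[e odd]`) for the value of the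
u-charge profile `U` at a member with `e` events (`V = U` at the creating main `M`, which counts as `e = 0`),
the whole of F14(2)–(3) is the pair of telescoping identities `memberU_step_ahead` / `memberU_step_behind`
below plus `memberU_mem_pair` (two values) and `abs_channel_charge_le_u` (`|c_C| ≤ 1`); R₂″ is then the
one-line `full_range_le` (skeleton window `d + t` from R₂′, plus the diameter of the profile's value set), with
the `p = 1` value sets handled by `p1_values_within_2u` / `p1_values_within_u`, and §Q′.7's count
("a K4′ witness needs the profile diameter to be at least `3u`") is `stack_needed`.

What is formalised (elementary; `[ours]`); the kinematic/combinatorial layer (chords, events, FIFO, coherence,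
periodicity) stays prose, exactly as in the two sibling files:
* `two_mul_alt_sum_range`, `two_mul_alt_sum_Ico` — `2·Σ_{j<n} (−1)^j = 1 − (−1)^n`, interval version.
* `alt_sum_Ico_two_valued`, `abs_alt_sum_Ico_le_one`, `abs_queue_charge_le_one` — partial sums of an alternating
  sign list take two values; every queue has net charge `0` or `±1` (F14(2): `|q(S)| ≤ 1`).
* `memberU`, `memberU_mem_pair`, `memberU_step_ahead`, `memberU_step_behind` — the profile values at members and
  the telescoping across a queue (F14(2): `U ∈ {V, V − χu}` on the whole channel).
* `abs_channel_charge_le_u` — F14(3): `|U(P-end) − U(M-end)| ≤ u`, i.e. `|c_C| ≤ 1`.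
* `pair_event_charge` — a u-event inserts/removes a `∓χ, ±χ` pair around its host: net charge unchanged
  (the invariance half of F14(3)).
* `full_range_le` — R₂″: `θ = θ_skel + U`, `θ_skel` in a window of width `W`, `U ∈ [m, m + D]` ⇒ range `≤ W + D`.
* `p1_values_within_2u`, `p1_values_within_u` — R₂″ for `p = 1`: the value set `{V, V − χ_L u, V − χ_R u}` has
  diameter `≤ 2u`, and `≤ u` when `χ_L = χ_R`.
* `stack_needed` — §Q′.7: at K4′ sizes `(δ, δ−η, δ−2η)`, `d + t + k·u ≥ 4δ` forces `k ≥ 3`.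
* `tcharge_zero_ucharge_zero` — F12′(d): `t·Q_t + u·Q_u = 0`, `Q_t = 0`, `u ≠ 0` ⇒ `Q_u = 0`.
Nothing is claimed about Navier–Stokes.
-/

namespace Summit.NavierStokesRegularity.FunctionalMining.TwoNotch

open Finset

/-! ### Alternating sums -/

/-- `2·Σ_{j<n} (−1)^j = 1 − (−1)^n`. -/
theorem two_mul_alt_sum_range (n : ℕ) :
    2 * ∑ j ∈ range n, (-1 : ℤ) ^ j = 1 - (-1) ^ n := by
  induction n with
  | zero => simp
  | succ n ih =>
    rw [sum_range_succ, mul_add, ih, pow_succ]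
    ring

/-- Interval version: `2·Σ_{m ≤ j < n} (−1)^j = (−1)^m − (−1)^n`. -/
theorem two_mul_alt_sum_Ico {m n : ℕ} (h : m ≤ n) :
    2 * ∑ j ∈ Ico m n, (-1 : ℤ) ^ j = (-1) ^ m - (-1) ^ n := by
  rw [sum_Ico_eq_sub _ h, mul_sub, two_mul_alt_sum_range, two_mul_alt_sum_range]
  ring

/-- F14(2), queue charge in units of `u`: a queue whose elements carry the signs `χ·(−1)^j`, `j ∈ [m, n)`,
has twice-net-charge `χ·((−1)^m − (−1)^n)`. -/
theorem queue_charge (χ : ℤ) {m n : ℕ} (h : m ≤ n) :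
    2 * ∑ j ∈ Ico m n, χ * (-1 : ℤ) ^ j = χ * ((-1) ^ m - (-1) ^ n) := by
  rw [← mul_sum, ← two_mul_alt_sum_Ico h]
  ring

/-- F14(2), two values: the partial sums of an alternating sign list are `0` or `(−1)^m`. -/
theorem alt_sum_Ico_two_valued {m n : ℕ} (h : m ≤ n) :
    ∑ j ∈ Ico m n, (-1 : ℤ) ^ j = 0 ∨ ∑ j ∈ Ico m n, (-1 : ℤ) ^ j = (-1) ^ m := by
  have h2 := two_mul_alt_sum_Ico h
  rcases neg_one_pow_eq_or ℤ m with hm | hm <;> rcases neg_one_pow_eq_or ℤ n with hn | hn <;>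
    rw [hm, hn] at h2 <;> rw [hm] <;> omega

/-- F14(2): `|q(S)| ≤ 1` for the bare alternating list. -/
theorem abs_alt_sum_Ico_le_one {m n : ℕ} (h : m ≤ n) :
    |∑ j ∈ Ico m n, (-1 : ℤ) ^ j| ≤ 1 := by
  rcases alt_sum_Ico_two_valued h with h0 | h1
  · rw [h0]; simp
  · rw [h1]; rcases neg_one_pow_eq_or ℤ m with hm | hm <;> rw [hm] <;> simp

/-- F14(2): every u-queue of a live channel has net charge `0` or `±1` (in units of `u`). -/
theorem abs_queue_charge_le_one (χ : ℤ) (hχ : χ = 1 ∨ χ = -1) {m n : ℕ} (h : m ≤ n) :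
    |∑ j ∈ Ico m n, χ * (-1 : ℤ) ^ j| ≤ 1 := by
  rw [← mul_sum, abs_mul]
  have h1 : |χ| = 1 := by rcases hχ with rfl | rfl <;> simp
  rw [h1, one_mul]
  exact abs_alt_sum_Ico_le_one h

/-! ### The profile at members; telescoping across queues -/

/-- The value of the u-charge profile at a member with `e` events so far, in a channel of absolute chirality `χ`
whose creating main carries the value `V`: `V − χ·u·[e odd]`, written with `(1 − (−1)^e)/2 = [e odd]`. -/
noncomputable def memberU (V χ u : ℝ) (e : ℕ) : ℝ := V - χ * u * (1 - (-1) ^ e) / 2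

/-- F14(2): the profile at a member is one of the two channel values `V`, `V − χ·u`. -/
theorem memberU_mem_pair (V χ u : ℝ) (e : ℕ) :
    memberU V χ u e = V ∨ memberU V χ u e = V - χ * u := by
  unfold memberU
  rcases neg_one_pow_eq_or ℝ e with h | h <;> rw [h]
  · left; ring
  · right; ring

/-- The creating main counts as a member with no events: `U(M) = V`. -/
theorem memberU_zero (V χ u : ℝ) : memberU V χ u 0 = V := by
  unfold memberU; simp

/-- F14(2), telescoping OUTWARD across an ahead-queue (or across `S_n` from `M`, or across the ghost pack to `P`):
starting from the value at a member with `m` events and adding the charges `u·(−χ)(−1)^j`, `j = m, …, n−1`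
(the behind-deposits of the `−t` further out, oldest first), one lands on the value of a member with `n` events. -/
theorem memberU_step_ahead (V χ u : ℝ) {m n : ℕ} (h : m ≤ n) :
    memberU V χ u m + u * ∑ j ∈ Ico m n, (-χ) * (-1 : ℝ) ^ j = memberU V χ u n := by
  have key : 2 * ∑ j ∈ Ico m n, (-1 : ℝ) ^ j = (-1) ^ m - (-1) ^ n := by
    have := two_mul_alt_sum_Ico h
    exact_mod_cast this
  unfold memberU
  rw [← mul_sum]
  have k2 : ∑ j ∈ Ico m n, (-1 : ℝ) ^ j = ((-1) ^ m - (-1) ^ n) / 2 := by linarith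
  rw [k2]; ring

/-- F14(2), telescoping across a behind-queue: from the `−t` with `n` events (inner end) across its ahead-deposits
`u·χ(−1)^j`, `j = m, …, n−1` (those not yet removed by the `+t` with `m` events further out), one lands on that
`+t`'s value. -/
theorem memberU_step_behind (V χ u : ℝ) {m n : ℕ} (h : m ≤ n) :
    memberU V χ u n + u * ∑ j ∈ Ico m n, χ * (-1 : ℝ) ^ j = memberU V χ u m := by
  have ha := memberU_step_ahead V χ u h
  have hs : ∑ j ∈ Ico m n, χ * (-1 : ℝ) ^ j = -∑ j ∈ Ico m n, (-χ) * (-1 : ℝ) ^ j := by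
    rw [← sum_neg_distrib]; congr 1; ext j; ring
  rw [hs]; linarith

/-- F14(3): the channel charge. `U(P-end) = memberU V χ u e` with `e = e^fin` of the front `−t` (or of the ghost),
so `U(P-end) − U(M-end) = −χ·u·[e odd]` and `|c_C·u| ≤ u`, i.e. `|c_C| ≤ 1`. -/
theorem abs_channel_charge_le_u (V χ u : ℝ) (hχ : χ = 1 ∨ χ = -1) (hu : 0 ≤ u) (e : ℕ) :
    |memberU V χ u e - V| ≤ u := by
  rcases memberU_mem_pair V χ u e with h | h <;> rw [h]
  · simp [hu]
  · rcases hχ with rfl | rfl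
    · rw [show V - 1 * u - V = -u by ring, abs_neg, abs_of_nonneg hu]
    · rw [show V - -1 * u - V = u by ring, abs_of_nonneg hu]

/-- Invariance half of F14(3): a u-event inserts (emission) or deletes (absorption) a pair `∓s, ±s` on the two
sides of its host, which itself carries no u-charge; the net u-charge of the channel is unchanged. -/
theorem pair_event_charge (l₁ l₂ : List ℤ) (s : ℤ) :
    (l₁ ++ [-s, 0, s] ++ l₂).sum = (l₁ ++ [0] ++ l₂).sum := by
  simp

/-! ### THEOREM R₂″: the static bound on the full range -/

/-- R₂″, arithmetic core. On a line, the full level is `θ x = θs x + U x` with the skeleton level `θs` in a window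
`[a, a + W]` (R₂′: `W = d + t`) and the u-charge profile `U` in `[m, m + D]` (`D = diam 𝒰`); then every rise
`θ x − θ y` is at most `W + D`. -/
theorem full_range_le {ι : Type*} (θ θs U : ι → ℝ) {a W m D : ℝ}
    (hθ : ∀ x, θ x = θs x + U x) (hs : ∀ x, a ≤ θs x ∧ θs x ≤ a + W)
    (hU : ∀ x, m ≤ U x ∧ U x ≤ m + D) (x y : ι) : θ x - θ y ≤ W + D := by
  rw [hθ x, hθ y]
  obtain ⟨h1, h2⟩ := hs x; obtain ⟨h3, h4⟩ := hs y
  obtain ⟨h5, h6⟩ := hU x; obtain ⟨h7, h8⟩ := hU y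
  linarith

/-- R₂″, `p = 1`: the profile's value set is `{V, V − χ_L·u, V − χ_R·u}` (F14(4) with one block); any two of
its elements differ by at most `2u`. -/
theorem p1_values_within_2u (V χL χR u : ℝ) (hL : χL = 1 ∨ χL = -1) (hR : χR = 1 ∨ χR = -1) (hu : 0 ≤ u)
    (a b : ℝ) (ha : a = V ∨ a = V - χL * u ∨ a = V - χR * u) (hb : b = V ∨ b = V - χL * u ∨ b = V - χR * u) :
    a - b ≤ 2 * u := by
  rcases hL with rfl | rfl <;> rcases hR with rfl | rfl <;>
    rcases ha with rfl | rfl | rfl <;> rcases hb with rfl | rfl | rfl <;> linarith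

/-- R₂″, `p = 1` with `χ_L = χ_R` (in particular for ODD channels, where `Q_u = 0` forces it): diameter `≤ u`,
so the full range is at most `d + t + u` — attained by census-2's certified orbit (`0.54` at `(.2, .18, .16)`). -/
theorem p1_values_within_u (V χ u : ℝ) (hχ : χ = 1 ∨ χ = -1) (hu : 0 ≤ u)
    (a b : ℝ) (ha : a = V ∨ a = V - χ * u) (hb : b = V ∨ b = V - χ * u) :
    a - b ≤ u := by
  rcases hχ with rfl | rfl <;> rcases ha with rfl | rfl <;> rcases hb with rfl | rfl <;> linarith

/-- The numerical instance of record: `d + t + u = 0.54` at `(d, t, u) = (0.2, 0.18, 0.16)`. -/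
theorem p1_bound_at_record_sizes : (0.2 : ℝ) + 0.18 + 0.16 = 0.54 := by norm_num

/-- §Q′.7: at K4′ sizes `(d, t, u) = (δ, δ − η, δ − 2η)` with `0 < η` and `2η < δ`, a full range `≥ 4δ` bounded by
`d + t + k·u` (the profile diameter being `k·u`, `k ∈ ℕ`, since all profile values lie in `V + u·ℤ`) needs `k ≥ 3`:
the static channel charges must STACK (`p ≥ 2`). -/
theorem stack_needed {δ η : ℝ} (hη : 0 < η) (hδ : 2 * η < δ) (k : ℕ)
    (h : 4 * δ ≤ δ + (δ - η) + (k : ℝ) * (δ - 2 * η)) : 3 ≤ k := by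
  by_contra hk
  have hk2 : (k : ℝ) ≤ 2 := by exact_mod_cast (by omega : k ≤ 2)
  have hu : 0 < δ - 2 * η := by linarith
  have : (k : ℝ) * (δ - 2 * η) ≤ 2 * (δ - 2 * η) := mul_le_mul_of_nonneg_right hk2 hu.le
  linarith

/-- F12′(d): the jumps around the circle sum to zero and the mains balance, so `t·Q_t + u·Q_u = 0`; with
`Q_t = 0` (R₂′) and `u ≠ 0` this gives `Q_u = 0`. -/
theorem tcharge_zero_ucharge_zero {t u : ℝ} {Qt Qu : ℤ} (hu : u ≠ 0)
    (hsum : t * Qt + u * Qu = 0) (hQt : Qt = 0) : Qu = 0 := by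
  subst hQt
  have h : u * (Qu : ℝ) = 0 := by simpa using hsum
  rcases mul_eq_zero.mp h with h | h
  · exact absurd h hu
  · exact_mod_cast h

end Summit.NavierStokesRegularity.FunctionalMining.TwoNotch
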